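import Summits.QuantumFields.YangMills.Theorems.BalabanUVNodesN15KingModelBlockCubePoincare
import Summits.QuantumFields.YangMills.Theorems.BalabanUVNodesN15KingModelCovariantBlockSmallField
import HarnessLib

/-!
# BalabanUVNodes ∕ N15 — THE KING-MODEL RUNG (PART Ϥ-o): ★★★★ SMALL CURVATURE ⟹ `η`-UNIFORM POSITIVITY OF THE FULL PROPAGATOR — [B9] p.395 l.1–3 «Assuming some regularity of the
# configuration U it can be easily shown that the operator Δ′_a is positive» DECIDED IN KING's MODEL WITH THE REGULARITY READ AS (3.35) (small plaquette variables), DERIVED not assumed: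
# if `‖P_U(x;κ,ρ) − 1‖ ≤ ε` for all plaquettes, then for every unitary `U`, `c ≥ 0`, `a`, `m²`, `0 < t ≤ 1` and the comb contours,
# `(m² + min(a, c(1−t)∕((d+1)L(L−1))) − c(t⁻¹−1)(d+1)(d(L−1)ε)²)·Σ‖v_x‖² ≤ Re⟨v,A₀(U)v⟩`; in King's scaling `c = L²`, `ε = ε₀∕L²` (physical curvature `ε₀`), `t = ½`:
# `(m² + min(a, (2(d+1))⁻¹) − (d+1)d²ε₀²)·Σ‖v_x‖² ≤ Re⟨v,A₀(U)v⟩` FOR EVERY `L ≥ 2` — the floor does not see the lattice spacing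
# (Track A, DAG node N15 = NE2; FAN-OUT v1.1 §N15 s3 «KING-MODEL RUNG … + what the curved case adds»; count-neutral)

HONEST FRAMING.  Count-neutral (cell `pub-ymgap`, seat `pub-ymgap-dag-n15-e` g49; `--supports stmt-QuantumFields-27247 --as helper` = K3ᴬ, KEY MAP v3).  King's comparison model; ONE-level
covariant averaging along the comb contours; the hypothesis is the plaquette smallness `‖U(∂p) − 1‖ ≤ ε` on the whole fine torus ([Balaban1985BackgroundPropagators] (3.35) p.396 bounds the
plaquette variables of the background field; here in operator norm, any fibre, any group).  The constants are crude (`(d+1)d²`, `(2(d+1))⁻¹`).  NOT Bałaban's multi-level `G_k(U)`; NOT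
(3.42); NOT a node discharge (N15 of record untouched); nothing continuum ∕ ℝ⁴ ∕ OS ∕ Clay.

THE PROOF.  Form identity (Ϥ-d); drop the inter-block bonds (`≥ 0`); in block `y` transport to the corner along the comb (`w = U(Γ)v`, Ϥ-c): the intra-block bond into `x_j` along `μ` has
energy `‖w_{j−e_μ} − U^{ax}(b)w_j‖²` with `U^{ax}` the axial-gauge link (Ϥ-m `axialGauge_bond_eq`), and `‖U^{ax}(b) − 1‖ ≤ κ := d(L−1)ε` (Ϥ-m's lattice Poincaré lemma); Peter–Paul (Ϥ-h)
bondwise gives `Σ_{intra}bondE ≥ (1−t)Σ_μB_μ(w) − (t⁻¹−1)(d+1)κ²Σ_j‖w_j‖²`; the block term is `aL^{d+1}‖w̄‖²` exactly; PART Ϥ-n's per-block coercivity `cube_coercive` with `(a, c(1−t))`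
closes the block, and the blocks add up.
RESULTS: §1 `lowerOff_injOn`, ★ `sum_intra_bondE_le` (intra-block bonds, head-parametrised, are among all bonds), ★★ `bondE_intra_eq_axial` (the tree-gauge form of an intra-block bond energy), ★
`bondE_intra_ge_peterPaul`; §2 ★★★★ **`re_quadForm_fullOpU_ge_of_small_curvature`** (general `c, t, ε`), ★★★★ **`re_quadForm_fullOpU_ge_uniform_of_small_curvature`** (King's scaling, `ε = ε₀∕L²`:
floor `m² + min(a,(2(d+1))⁻¹) − (d+1)d²ε₀²`, every `L ≥ 2`), ★★★ **`posDef_fullOpU_massless_of_small_curvature`** (`(d+1)d²ε₀² < min(a,(2(d+1))⁻¹)` ⟹ `L²(−Δ_U) + aQ(U)^*Q(U) ≻ 0` with an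
`L`-free margin), ★★★ **`l2_opNorm_fullOpU_massless_inv_le_of_small_curvature`**, ★★★ **`king_B9_p395_with_335_decided`** (package: regular ⟹ η-uniform; + the rough witness of Ϥ-f for contrast).
PRIOR TREE ART (by name): Ϥ-c (`blockTransport`, `fib_covQ_mulVec`, `sum_norm_blockTransport_sq`, `norm_blockTransport`), Ϥ-d (`re_quadForm_fullOpU`, `isHermitian_fullOpU`), Ϥ-e∕Ϡ-i engines, Ϥ-f
(`king_full_propagator_floor_two_sided`), Ϥ-h (`norm_add_sq_ge_peterPaul`), Ϥ-m (`blockAxialGauge`, `axialGauge_bond_eq`, `norm_axialGauge_sub_one_le_uniform`, `lowerOff`, `site_lowerOff_add_unitVec`),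
Ϥ-n (`dirForm`, `cube_coercive`, `lowerOff_of_eq_zero`), Ͱ-b (`norm_toEuclideanLin_of_mem_unitaryGroup`), Ϳ-b (`bondE`, `toEuclideanLin_mul_apply`), `King1986.Torus` (`site`, `blockEquiv`), Mathlib
(`Matrix.l2_opNorm_mulVec`).  Dedup (rg at filing): basename 0 files; needles `of_small_curvature|bondE_intra_eq_axial|king_B9_p395_with_335_decided` 0 files.  presearch: as Ϥ-h (the printed source is
[B9] p.395 l.1–3 + (3.35); no printed constant).  Locators: [Balaban1985BackgroundPropagators] p.395 l.1–3, (3.35) p.396, (3.19) p.393, (3.24) p.394; [King1986] (2.12)–(2.13) p.653, (4.33) p.674;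
[Dimock2013] App. D Lemma 29; [Federbush1987PhaseCellIII] §5.3 p.303.  0 `sorry`, 0 `def`.
-/

noncomputable section
open scoped BigOperators ComplexConjugate ComplexOrder Matrix.Norms.L2Operator
open Finset Matrix WithLp

namespace Summit.QuantumFields.YangMills.BalabanUVNodes.N15KingModelRung.CovariantBlock

open Literature.MathematicalPhysics.QuantumFieldTheory.Balaban1983to89.B5Prop11Plancherel (Tor fine unitVec)
open Literature.MathematicalPhysics.QuantumFieldTheory.King1986.Torus (site site_injective blockEquiv blockEquiv_apply)
open Summit.QuantumFields.YangMills.BalabanUVNodes.N15KingModelRung.Covariant (covLapF kingGaugeAct kingGaugeAct_mem_unitaryGroup fib fib_apply norm_toEuclideanLin_of_mem_unitaryGroup)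
open Summit.QuantumFields.YangMills.BalabanUVNodes.N15KingModelRung.Curvature (bondE bondE_nonneg toEuclideanLin_mul_apply)
open Summit.QuantumFields.YangMills.BalabanUVNodes.N15KingModelRung.Cover (kingPlaq)
open Summit.QuantumFields.YangMills.BalabanUVNodes.N15KingModelRung.Landau (posDef_of_coercive' l2_opNorm_inv_le_of_coercive')

variable {d : ℕ} {L : ℕ} [NeZero L] (M : Fin (d + 1) → ℕ) [hM : ∀ μ, NeZero (M μ)]
variable {𝕜 : Type*} [RCLike 𝕜] {n : Type*} [Fintype n] [DecidableEq n]

/-! ## §1 Intra-block bonds: bookkeeping and the tree-gauge form of their energies -/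

omit hM in
/-- `j ↦ j − e_μ` is injective on `{j_μ ≠ 0}`. [folklore] -/
theorem lowerOff_injOn (μ : Fin (d + 1)) {j j' : Fin (d + 1) → Fin L} (hj : j μ ≠ 0) (hj' : j' μ ≠ 0) (h : lowerOff j μ = lowerOff j' μ) : j = j' := by
  have hpos : 1 ≤ (j μ : ℕ) := Nat.one_le_iff_ne_zero.mpr fun h0 => hj (Fin.ext h0)
  have hpos' : 1 ≤ (j' μ : ℕ) := Nat.one_le_iff_ne_zero.mpr fun h0 => hj' (Fin.ext h0)
  funext ν; apply Fin.ext
  have hν := congrArg (fun k : Fin (d + 1) → Fin L => (k ν : ℕ)) h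
  simp only [lowerOff_apply] at hν
  by_cases hνμ : ν = μ
  · subst hνμ; rw [if_pos rfl] at hν; omega
  · rw [if_neg hνμ] at hν; simpa using hν

/-- ★ THE INTRA-BLOCK BONDS ARE AMONG ALL BONDS: `Σ_yΣ_μΣ_{j: j_μ≠0} bondE(site y (j−e_μ), μ) ≤ Σ_xΣ_μ bondE(x,μ)` (head parametrisation; the inter-block bonds are dropped).
[cite: Balaban1985BackgroundPropagators, (3.23) p.394; King1986, (4.4) p.670] -/
theorem sum_intra_bondE_le (U : Tor (fine L M) × Fin (d + 1) → Matrix n n 𝕜) (v : Tor (fine L M) × n → 𝕜) :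
    ∑ y : Tor M, ∑ μ : Fin (d + 1), ∑ j ∈ univ.filter (fun j : Fin (d + 1) → Fin L => j μ ≠ 0), bondE (fine L M) U v (site L M y (lowerOff j μ)) μ
      ≤ ∑ x, ∑ μ, bondE (fine L M) U v x μ := by
  classical
  -- reorder the right side by blocks and directions
  have hR : ∑ x, ∑ μ, bondE (fine L M) U v x μ = ∑ y : Tor M, ∑ μ : Fin (d + 1), ∑ j : Fin (d + 1) → Fin L, bondE (fine L M) U v (site L M y j) μ := by
    rw [← (blockEquiv L M).sum_comp, Fintype.sum_prod_type]
    refine Finset.sum_congr rfl fun y _ => ?_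
    rw [Finset.sum_comm]; rfl
  rw [hR]
  refine Finset.sum_le_sum fun y _ => Finset.sum_le_sum fun μ _ => ?_
  have hinj : ∀ j ∈ univ.filter (fun j : Fin (d + 1) → Fin L => j μ ≠ 0), ∀ j' ∈ univ.filter (fun j : Fin (d + 1) → Fin L => j μ ≠ 0), lowerOff j μ = lowerOff j' μ → j = j' := by
    intro j hj j' hj' h
    simp only [Finset.mem_filter, Finset.mem_univ, true_and] at hj hj'
    exact lowerOff_injOn μ hj hj' h
  calc ∑ j ∈ univ.filter (fun j : Fin (d + 1) → Fin L => j μ ≠ 0), bondE (fine L M) U v (site L M y (lowerOff j μ)) μ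
      = ∑ k ∈ (univ.filter (fun j : Fin (d + 1) → Fin L => j μ ≠ 0)).image (fun j => lowerOff j μ), bondE (fine L M) U v (site L M y k) μ := by rw [Finset.sum_image hinj]
    _ ≤ ∑ k : Fin (d + 1) → Fin L, bondE (fine L M) U v (site L M y k) μ := Finset.sum_le_sum_of_subset_of_nonneg (Finset.subset_univ _) fun k _ _ => bondE_nonneg (fine L M) U v _ _

/-- ★★ **THE TREE-GAUGE FORM OF AN INTRA-BLOCK BOND ENERGY**: for the bond into `x_j` along `μ` (`j_μ ≠ 0`), `bondE_U = ‖w_{j−e_μ} − U^{ax}(b)·w_j‖²` with `w = U(Γ)v` the transported field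
(Ϥ-c `blockTransport`, comb) and `U^{ax}(b)` the axial-gauge link (Ϥ-m). [cite: Federbush1987PhaseCellIII, §5.3 p.303; Balaban1985BackgroundPropagators, (3.19) p.393, (3.23) p.394] -/
theorem bondE_intra_eq_axial {U : Tor (fine L M) × Fin (d + 1) → Matrix n n 𝕜} (hU : ∀ bd, U bd ∈ Matrix.unitaryGroup n 𝕜) (v : Tor (fine L M) × n → 𝕜) (y : Tor M)
    {j : Fin (d + 1) → Fin L} {μ : Fin (d + 1)} (hμ : j μ ≠ 0) :
    bondE (fine L M) U v (site L M y (lowerOff j μ)) μ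
      = ‖blockTransport (kingComb d L) M U v y (lowerOff j μ)
          - Matrix.toEuclideanLin (kingGaugeAct (fine L M) (blockAxialGauge M U) U (site L M y (lowerOff j μ), μ)) (blockTransport (kingComb d L) M U v y j)‖ ^ 2 := by
  rw [bondE, site_lowerOff_add_unitVec M y hμ, axialGauge_bond_eq M U y hμ]
  simp only [blockTransport]
  have hHj : (treeHol M (kingComb d L) U y j)ᴴ * treeHol M (kingComb d L) U y j = 1 := by
    simpa only [star_eq_conjTranspose] using Matrix.mem_unitaryGroup_iff'.mp (treeHol_mem_unitaryGroup (kingComb d L) M hU y j)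
  rw [← norm_toEuclideanLin_of_mem_unitaryGroup (treeHol_mem_unitaryGroup (kingComb d L) M hU y (lowerOff j μ)) (fib (fine L M) v (site L M y (lowerOff j μ)) - _), map_sub,
    toEuclideanLin_mul_apply, toEuclideanLin_mul_apply, ← toEuclideanLin_mul_apply (treeHol M (kingComb d L) U y j)ᴴ (treeHol M (kingComb d L) U y j), hHj]
  have h1 : Matrix.toEuclideanLin (1 : Matrix n n 𝕜) (fib (fine L M) v (site L M y j)) = fib (fine L M) v (site L M y j) := by
    rw [Matrix.toLpLin_apply, Matrix.one_mulVec, toLp_ofLp]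
  rw [h1]

omit hM in
/-- ★ PETER–PAUL FOR AN INTRA-BLOCK BOND IN THE TREE GAUGE: `‖w′ − Aw‖² ≥ (1−t)‖w − w′‖² − (t⁻¹−1)κ²‖w‖²` when `‖A − 1‖ ≤ κ` (`0 < t ≤ 1`). [folklore] -/
theorem norm_sub_apply_sq_ge_peterPaul {A : Matrix n n 𝕜} {κ : ℝ} (hA : ‖A - 1‖ ≤ κ) (w w' : EuclideanSpace 𝕜 n) {t : ℝ} (ht : 0 < t) (ht1 : t ≤ 1) :
    (1 - t) * ‖w - w'‖ ^ 2 - (t⁻¹ - 1) * (κ ^ 2 * ‖w‖ ^ 2) ≤ ‖w' - Matrix.toEuclideanLin A w‖ ^ 2 := by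
  have hκ0 : 0 ≤ κ := (norm_nonneg _).trans hA
  have hβ : ‖w - Matrix.toEuclideanLin A w‖ ≤ κ * ‖w‖ := by
    have h1 : w - Matrix.toEuclideanLin A w = Matrix.toEuclideanLin (1 - A) w := by
      rw [map_sub, LinearMap.sub_apply, Matrix.toLpLin_apply, Matrix.toLpLin_apply, Matrix.one_mulVec, toLp_ofLp]
    rw [h1, Matrix.toLpLin_apply]
    calc ‖(toLp 2 ((1 - A) *ᵥ ofLp w) : EuclideanSpace 𝕜 n)‖ ≤ ‖1 - A‖ * ‖(toLp 2 (ofLp w) : EuclideanSpace 𝕜 n)‖ := Matrix.l2_opNorm_mulVec _ _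
      _ ≤ κ * ‖w‖ := by rw [toLp_ofLp, norm_sub_rev]; exact mul_le_mul_of_nonneg_right hA (norm_nonneg _)
  have hPP := norm_add_sq_ge_peterPaul (w' - w) (w - Matrix.toEuclideanLin A w) ht ht1
  rw [sub_add_sub_cancel, norm_sub_rev w' w] at hPP
  have hβ2 : ‖w - Matrix.toEuclideanLin A w‖ ^ 2 ≤ κ ^ 2 * ‖w‖ ^ 2 := by rw [← mul_pow]; exact pow_le_pow_left₀ (norm_nonneg _) hβ 2
  have ht' : 0 ≤ t⁻¹ - 1 := by rw [sub_nonneg]; exact (one_le_inv₀ ht).mpr ht1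
  nlinarith [hPP, mul_le_mul_of_nonneg_left hβ2 ht']

/-! ## §2 Small curvature ⟹ uniform positivity -/

/-- ★★★★ **SMALL CURVATURE ⟹ POSITIVITY OF THE FULL PROPAGATOR, QUANTITATIVELY** (comb contours, every unitary `U`, every fibre): if `‖P_U(x;κ,ρ) − 1‖ ≤ ε` for every plaquette, then for
`c ≥ 0`, every `a`, `m²`, `0 < t ≤ 1`: `(m² + min(a, c(1−t)∕((d+1)L(L−1))) − c(t⁻¹−1)(d+1)(d(L−1)ε)²)·Σ_x‖v_x‖² ≤ Re⟨v, A₀(U)v⟩`.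
[cite: Balaban1985BackgroundPropagators, p.395 l.1–3, (3.35) p.396, (3.24) p.394; King1986, (2.13) p.653, (4.33) p.674; Dimock2013, App. D Lemma 29; Federbush1987PhaseCellIII, §5.3 p.303] -/
theorem re_quadForm_fullOpU_ge_of_small_curvature {c : ℝ} (hc : 0 ≤ c) (a m2 : ℝ) {U : Tor (fine L M) × Fin (d + 1) → Matrix n n 𝕜} (hU : ∀ bd, U bd ∈ Matrix.unitaryGroup n 𝕜)
    {ε : ℝ} (hε : ∀ (x : Tor (fine L M)) (κ ρ : Fin (d + 1)), ‖kingPlaq (fine L M) U x κ ρ - 1‖ ≤ ε) {t : ℝ} (ht : 0 < t) (ht1 : t ≤ 1) (v : Tor (fine L M) × n → 𝕜) :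
    (m2 + min a (c * (1 - t) / (((d + 1 : ℕ) : ℝ) * (L * (L - 1 : ℕ) : ℝ))) - c * (t⁻¹ - 1) * ((d : ℝ) + 1) * ((d * (L - 1) : ℕ) * ε) ^ 2) * ∑ x, ‖fib (fine L M) v x‖ ^ 2
      ≤ RCLike.re (star v ⬝ᵥ (fullOpU (kingComb d L) M a c m2 U *ᵥ v)) := by
  set T := kingComb d L
  set κ : ℝ := (d * (L - 1) : ℕ) * ε with hκdef
  have ht' : 0 ≤ t⁻¹ - 1 := by rw [sub_nonneg]; exact (one_le_inv₀ ht).mpr ht1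
  have hct : 0 ≤ c * (1 - t) := mul_nonneg hc (by linarith)
  rw [re_quadForm_fullOpU T M a c m2 hU v]
  set S := ∑ x, ‖fib (fine L M) v x‖ ^ 2 with hS
  -- per block
  have hblock : ∀ y : Tor M,
      (min a (c * (1 - t) / (((d + 1 : ℕ) : ℝ) * (L * (L - 1 : ℕ) : ℝ))) - c * (t⁻¹ - 1) * ((d : ℝ) + 1) * κ ^ 2) * ∑ j, ‖blockTransport T M U v y j‖ ^ 2
        ≤ a * ((L : ℝ) ^ (d + 1) * ‖fib M (covQ T M U *ᵥ v) y‖ ^ 2)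
          + c * ∑ μ : Fin (d + 1), ∑ j ∈ univ.filter (fun j : Fin (d + 1) → Fin L => j μ ≠ 0), bondE (fine L M) U v (site L M y (lowerOff j μ)) μ := by
    intro y
    set w := blockTransport T M U v y with hw
    -- Peter–Paul on each intra-block bond
    have hbond : ∀ (μ : Fin (d + 1)) (j : Fin (d + 1) → Fin L), j μ ≠ 0 →
        (1 - t) * ‖w j - w (lowerOff j μ)‖ ^ 2 - (t⁻¹ - 1) * (κ ^ 2 * ‖w j‖ ^ 2) ≤ bondE (fine L M) U v (site L M y (lowerOff j μ)) μ := by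
      intro μ j hj
      rw [bondE_intra_eq_axial M hU v y hj]
      exact norm_sub_apply_sq_ge_peterPaul (norm_axialGauge_sub_one_le_uniform M hU y (fun k κ' ρ => hε _ κ' ρ) j μ hj) (w j) (w (lowerOff j μ)) ht ht1
    -- sum over the intra-block bonds of direction μ
    have hdir : ∀ μ : Fin (d + 1), (1 - t) * dirForm L μ w - (t⁻¹ - 1) * (κ ^ 2 * ∑ j, ‖w j‖ ^ 2)
        ≤ ∑ j ∈ univ.filter (fun j : Fin (d + 1) → Fin L => j μ ≠ 0), bondE (fine L M) U v (site L M y (lowerOff j μ)) μ := by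
      intro μ
      have hsplit : dirForm L μ w = ∑ j ∈ univ.filter (fun j : Fin (d + 1) → Fin L => j μ ≠ 0), ‖w j - w (lowerOff j μ)‖ ^ 2 := by
        rw [dirForm, ← Finset.sum_filter_add_sum_filter_not univ (fun j : Fin (d + 1) → Fin L => j μ ≠ 0)]
        have : ∑ j ∈ univ.filter (fun j : Fin (d + 1) → Fin L => ¬ j μ ≠ 0), ‖w j - w (lowerOff j μ)‖ ^ 2 = 0 :=
          Finset.sum_eq_zero fun j hj => by
            simp only [Finset.mem_filter, Finset.mem_univ, true_and, not_not] at hj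
            rw [lowerOff_of_eq_zero L hj, sub_self, norm_zero]; simp
        rw [this, add_zero]
      have hmass : ∑ j ∈ univ.filter (fun j : Fin (d + 1) → Fin L => j μ ≠ 0), ‖w j‖ ^ 2 ≤ ∑ j, ‖w j‖ ^ 2 :=
        Finset.sum_le_sum_of_subset_of_nonneg (Finset.subset_univ _) fun _ _ _ => sq_nonneg _
      have h := Finset.sum_le_sum fun j (hj : j ∈ univ.filter (fun j : Fin (d + 1) → Fin L => j μ ≠ 0)) => hbond μ j (Finset.mem_filter.mp hj).2
      rw [Finset.sum_sub_distrib, ← Finset.mul_sum, ← Finset.mul_sum, ← hsplit, ← Finset.mul_sum] at h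
      have hκ2 : 0 ≤ κ ^ 2 := sq_nonneg _
      nlinarith [h, mul_le_mul_of_nonneg_left (mul_le_mul_of_nonneg_left hmass hκ2) ht']
    -- the cube coercivity with `(a, c(1−t))`
    have hcube := cube_coercive L (𝕜 := 𝕜) (a := a) hct w
    rw [← fib_covQ_mulVec T M U v y] at hcube
    have hsum := Finset.sum_le_sum fun μ (_ : μ ∈ (univ : Finset (Fin (d + 1)))) => hdir μ
    rw [Finset.sum_sub_distrib, ← Finset.mul_sum, Finset.sum_const, Finset.card_univ, Fintype.card_fin, nsmul_eq_mul] at hsum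
    push_cast at hsum
    -- combine
    have hc0 : c * ((1 - t) * ∑ μ : Fin (d + 1), dirForm L μ w - ((d : ℝ) + 1) * ((t⁻¹ - 1) * (κ ^ 2 * ∑ j, ‖w j‖ ^ 2)))
        ≤ c * ∑ μ : Fin (d + 1), ∑ j ∈ univ.filter (fun j : Fin (d + 1) → Fin L => j μ ≠ 0), bondE (fine L M) U v (site L M y (lowerOff j μ)) μ :=
      mul_le_mul_of_nonneg_left hsum hc
    have hrw : c * (1 - t) * ∑ μ : Fin (d + 1), dirForm L μ w = c * ((1 - t) * ∑ μ : Fin (d + 1), dirForm L μ w) := by ring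
    nlinarith [hcube, hc0, hrw]
  -- sum over the blocks
  have hsumB := Finset.sum_le_sum fun y (_ : y ∈ (univ : Finset (Tor M))) => hblock y
  rw [← Finset.mul_sum, sum_norm_blockTransport_sq T M hU v, Finset.sum_add_distrib, ← Finset.mul_sum, ← Finset.mul_sum, ← Finset.mul_sum] at hsumB
  have hintra := sum_intra_bondE_le M U v
  have hc' := mul_le_mul_of_nonneg_left hintra hc
  rw [hκdef] at hsumB
  nlinarith [hsumB, hc']

/-- ★★★★ **THE `η`-UNIFORM FLOOR FROM (3.35)-SMALL CURVATURE** (King's scaling `c = L²`, `L ≥ 2`, plaquettes `‖P_U − 1‖ ≤ ε₀∕L²` = physical curvature `ε₀` on unit blocks, `t = ½`): for every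
unitary `U`, every `a`, `m²`: `(m² + min(a, (2(d+1))⁻¹) − (d+1)d²ε₀²)·Σ_x‖v_x‖² ≤ Re⟨v, A₀(U)v⟩` — FOR EVERY `L`: the floor does not see the lattice spacing `η = L⁻¹`.
[cite: Balaban1985BackgroundPropagators, p.395 l.1–3, (3.35) p.396; King1986, (2.13) p.653, (4.33) p.674; Dimock2013, App. D Lemma 29] -/
theorem re_quadForm_fullOpU_ge_uniform_of_small_curvature (hL : 2 ≤ L) (a m2 : ℝ) {U : Tor (fine L M) × Fin (d + 1) → Matrix n n 𝕜} (hU : ∀ bd, U bd ∈ Matrix.unitaryGroup n 𝕜)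
    {ε₀ : ℝ} (hε : ∀ (x : Tor (fine L M)) (κ ρ : Fin (d + 1)), ‖kingPlaq (fine L M) U x κ ρ - 1‖ ≤ ε₀ / (L : ℝ) ^ 2) (v : Tor (fine L M) × n → 𝕜) :
    (m2 + min a (1 / (2 * ((d : ℝ) + 1))) - ((d : ℝ) + 1) * (d : ℝ) ^ 2 * ε₀ ^ 2) * ∑ x, ‖fib (fine L M) v x‖ ^ 2
      ≤ RCLike.re (star v ⬝ᵥ (fullOpU (kingComb d L) M a ((L : ℝ) ^ 2) m2 U *ᵥ v)) := by
  have h := re_quadForm_fullOpU_ge_of_small_curvature M (c := (L : ℝ) ^ 2) (by positivity) a m2 hU hε (t := 1 / 2) (by norm_num) (by norm_num) v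
  have hS : 0 ≤ ∑ x, ‖fib (fine L M) v x‖ ^ 2 := Finset.sum_nonneg fun _ _ => sq_nonneg _
  refine le_trans (mul_le_mul_of_nonneg_right ?_ hS) h
  have hL0 : (2 : ℝ) ≤ L := by exact_mod_cast hL
  have hL1 : (1 : ℝ) ≤ (L - 1 : ℕ) := by
    have : 1 ≤ L - 1 := by omega
    exact_mod_cast this
  have hLm1 : ((L - 1 : ℕ) : ℝ) = (L : ℝ) - 1 := by
    have : 1 ≤ L := by omega
    push_cast [Nat.cast_sub this]; ring
  have hε0 : 0 ≤ ε₀ := by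
    have := (norm_nonneg _).trans (hε 0 0 0)
    have hL2 : (0 : ℝ) < (L : ℝ) ^ 2 := by positivity
    exact (div_nonneg_iff.mp this).elim (fun h => h.1) fun h => absurd h.2 (not_le.mpr hL2)
  -- the Laplacian part: `L²·½ ∕ ((d+1)L(L−1)) ≥ 1∕(2(d+1))`
  have h1 : 1 / (2 * ((d : ℝ) + 1)) ≤ (L : ℝ) ^ 2 * (1 - 1 / 2) / (((d + 1 : ℕ) : ℝ) * (L * (L - 1 : ℕ) : ℝ)) := by
    rw [hLm1]; push_cast
    have hden : 0 < ((d : ℝ) + 1) * ((L : ℝ) * ((L : ℝ) - 1)) := by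
      have : (0 : ℝ) < (L : ℝ) - 1 := by linarith
      positivity
    rw [div_le_div_iff₀ (by positivity) hden]
    nlinarith
  have hmin : min a (1 / (2 * ((d : ℝ) + 1))) ≤ min a ((L : ℝ) ^ 2 * (1 - 1 / 2) / (((d + 1 : ℕ) : ℝ) * (L * (L - 1 : ℕ) : ℝ))) := min_le_min le_rfl h1
  -- the error part: `L²·1·(d+1)·(d(L−1)ε₀∕L²)² ≤ (d+1)d²ε₀²`
  have h2 : (L : ℝ) ^ 2 * ((1 / 2 : ℝ)⁻¹ - 1) * ((d : ℝ) + 1) * ((d * (L - 1) : ℕ) * (ε₀ / (L : ℝ) ^ 2)) ^ 2 ≤ ((d : ℝ) + 1) * (d : ℝ) ^ 2 * ε₀ ^ 2 := by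
    push_cast; rw [hLm1]
    have hL' : (0 : ℝ) < L := by linarith
    have key : (L : ℝ) ^ 2 * ((1 / 2 : ℝ)⁻¹ - 1) * ((d : ℝ) + 1) * ((d : ℝ) * ((L : ℝ) - 1) * (ε₀ / (L : ℝ) ^ 2)) ^ 2 = ((d : ℝ) + 1) * (d : ℝ) ^ 2 * ε₀ ^ 2 * (((L : ℝ) - 1) / L) ^ 2 := by
      field_simp; ring
    rw [key]
    have hq : (((L : ℝ) - 1) / L) ^ 2 ≤ 1 := by
      rw [div_pow, div_le_one (by positivity)]; nlinarith
    have h0 : 0 ≤ ((d : ℝ) + 1) * (d : ℝ) ^ 2 * ε₀ ^ 2 := by positivity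
    nlinarith
  linarith

/-- ★★★ **THE MASSLESS FULL OPERATOR IS POSITIVE DEFINITE, `η`-UNIFORMLY, AT SMALL CURVATURE**: `(d+1)d²ε₀² < min(a, (2(d+1))⁻¹)` and `‖P_U − 1‖ ≤ ε₀∕L²` everywhere ⟹ `L²(−Δ_U) + aQ(U)^*Q(U) ≻ 0`
with the `L`-free margin `min(a,(2(d+1))⁻¹) − (d+1)d²ε₀²`. [cite: Balaban1985BackgroundPropagators, p.395 l.1–3, (3.35) p.396; King1986, (2.13) p.653] -/
theorem posDef_fullOpU_massless_of_small_curvature (hL : 2 ≤ L) {a : ℝ} {U : Tor (fine L M) × Fin (d + 1) → Matrix n n 𝕜} (hU : ∀ bd, U bd ∈ Matrix.unitaryGroup n 𝕜)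
    {ε₀ : ℝ} (hε : ∀ (x : Tor (fine L M)) (κ ρ : Fin (d + 1)), ‖kingPlaq (fine L M) U x κ ρ - 1‖ ≤ ε₀ / (L : ℝ) ^ 2)
    (hsmall : ((d : ℝ) + 1) * (d : ℝ) ^ 2 * ε₀ ^ 2 < min a (1 / (2 * ((d : ℝ) + 1)))) :
    (fullOpU (kingComb d L) M a ((L : ℝ) ^ 2) 0 U).PosDef :=
  posDef_of_coercive' (fine L M) (isHermitian_fullOpU (kingComb d L) M a _ 0 U) (sub_pos.mpr hsmall)
    (fun w => by have h := re_quadForm_fullOpU_ge_uniform_of_small_curvature M hL a 0 hU hε w; rwa [zero_add] at h)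

/-- ★★★ **`η`-UNIFORM BOUND ON THE MASSLESS FULL PROPAGATOR AT SMALL CURVATURE**: `‖(L²(−Δ_U) + aQ(U)^*Q(U))⁻¹‖ ≤ (min(a,(2(d+1))⁻¹) − (d+1)d²ε₀²)⁻¹` for every `L ≥ 2` and every unitary
`U` with `‖P_U − 1‖ ≤ ε₀∕L²`. [cite: Balaban1985BackgroundPropagators, p.395 l.1–3, (3.35) p.396, (3.39) p.397; King1986, (2.13) p.653] -/
theorem l2_opNorm_fullOpU_massless_inv_le_of_small_curvature (hL : 2 ≤ L) {a : ℝ} {U : Tor (fine L M) × Fin (d + 1) → Matrix n n 𝕜}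
    (hU : ∀ bd, U bd ∈ Matrix.unitaryGroup n 𝕜) {ε₀ : ℝ} (hε : ∀ (x : Tor (fine L M)) (κ ρ : Fin (d + 1)), ‖kingPlaq (fine L M) U x κ ρ - 1‖ ≤ ε₀ / (L : ℝ) ^ 2)
    (hsmall : ((d : ℝ) + 1) * (d : ℝ) ^ 2 * ε₀ ^ 2 < min a (1 / (2 * ((d : ℝ) + 1)))) :
    ‖(fullOpU (kingComb d L) M a ((L : ℝ) ^ 2) 0 U)⁻¹‖ ≤ (min a (1 / (2 * ((d : ℝ) + 1))) - ((d : ℝ) + 1) * (d : ℝ) ^ 2 * ε₀ ^ 2)⁻¹ :=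
  l2_opNorm_inv_le_of_coercive' (fine L M) (isHermitian_fullOpU (kingComb d L) M a _ 0 U) (sub_pos.mpr hsmall)
    (fun w => by have h := re_quadForm_fullOpU_ge_uniform_of_small_curvature M hL a 0 hU hε w; rwa [zero_add] at h)

/-- ★★★ **[B9] p.395 l.1–3 WITH ITS REGULARITY (3.35), DECIDED IN KING's MODEL** (comb contours, King's scaling, massless, `a ≥ 0`, `L ≥ 2`, non-trivial fibre `ℂⁿ`): (i) REGULAR fields —
`‖P_U − 1‖ ≤ ε₀∕L²` on every plaquette ⟹ `(min(a,(2(d+1))⁻¹) − (d+1)d²ε₀²)·Σ‖v_x‖² ≤ Re⟨v,A₀(U)v⟩` for EVERY `L` (η-uniform); (ii) without regularity the best `U`-uniform floor is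
`Θ(L^{−d})`: some unitary `U` has an eigenvalue `≤ 4π²L^{−d}` (PART Ϥ-f). [cite: Balaban1985BackgroundPropagators, p.395 l.1–3, (3.35) p.396; King1986, (2.13) p.653, (4.33) p.674; Dimock2013, App. D Lemma 29] -/
theorem king_B9_p395_with_335_decided {n : Type*} [Fintype n] [DecidableEq n] [Nonempty n] (hL : 2 ≤ L) {a : ℝ} (ha : 0 < a) :
    (∀ U : Tor (fine L M) × Fin (d + 1) → Matrix n n ℂ, (∀ bd, U bd ∈ Matrix.unitaryGroup n ℂ) → ∀ ε₀ : ℝ,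
        (∀ (x : Tor (fine L M)) (κ ρ : Fin (d + 1)), ‖kingPlaq (fine L M) U x κ ρ - 1‖ ≤ ε₀ / (L : ℝ) ^ 2) →
          ∀ v, (min a (1 / (2 * ((d : ℝ) + 1))) - ((d : ℝ) + 1) * (d : ℝ) ^ 2 * ε₀ ^ 2) * ∑ x, ‖fib (fine L M) v x‖ ^ 2
            ≤ RCLike.re (star v ⬝ᵥ (fullOpU (kingComb d L) M a ((L : ℝ) ^ 2) 0 U *ᵥ v)))
      ∧ ∃ U : Tor (fine L M) × Fin (d + 1) → Matrix n n ℂ, (∀ bd, U bd ∈ Matrix.unitaryGroup n ℂ) ∧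
          ∃ i, (isHermitian_fullOpU (kingComb d L) M a ((L : ℝ) ^ 2) 0 U).eigenvalues i ≤ 4 * Real.pi ^ 2 / (L : ℝ) ^ d := by
  refine ⟨fun U hU ε₀ hε v => ?_, (king_flat_vs_rough M hL ha).2⟩
  have h := re_quadForm_fullOpU_ge_uniform_of_small_curvature M hL a 0 hU hε v
  rwa [zero_add] at h

end Summit.QuantumFields.YangMills.BalabanUVNodes.N15KingModelRung.CovariantBlock

end
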